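import Literature.Computability.Complexity.NondeterministicKannanSearch
import Literature.Computability.Complexity.DTIMESubsetNTIME
import Literature.Computability.Complexity.CountingHierarchyProofs
import HarnessLib

/-!
# Closure properties of `EXP`: certificate search (`∃ᵖ·EXP = EXP`, `NP ⊆ EXP`), Karp preimages,
# `EXP ⊆ NEXP`

Literature / complexity toolkit (serves Murray–Williams 2017, Thm. 4.1,
`Barriers/PneNP/MCSPHardnessObstructions.lean`, whose exponential-time algorithm ends with an
exhaustive search over polynomially many certificate bits, and discharges the named fact
`NP_subset_EXP` of `Nondeterministic.lean`). Everything is assembled from the tree's machine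
toolkit; no machine is programmed here:

* the arithmetic currency `T n ≤ 2^{q(n)}`, `q` a polynomial, for membership in
  `EXP = ⋃ₖ DTIME(2^{nᵏ})` (`mem_EXP_of_le_two_pow_eval`, `exists_two_pow_eval_of_mem_EXP`);
* **`preimage_mem_EXP_of_mem_FP`**: `EXP` is closed under polynomial-time preimages (Karp
  reductions; sequential composition `TimeComputable.comp_holds`), `mem_EXP_of_karpReducible`;
* **`polyExists_EXP_subset_EXP : polyExists EXP ⊆ EXP`** — "enumerate all possible certificates
  and check each" (Arora–Barak 2009, §2.1, proof of Claim 2.4 `NP ⊆ EXP`), by the exhaustive-search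
  decider `NKannan.DecIn.bex` of `NondeterministicKannanSearch.lean` (bounded existential
  quantifier over words of an exact length, cost `2^{O(N + β n)} ×` the matrix time), the
  witnesses of length `≤ p(n)` being ranged over through their front-padding codes
  `0^{p(n)-|y|} 1 y ∈ {0,1}^{p(n)+1}` (`NKannan.decode`); dually `polyForall_EXP_subset_EXP`;
* **`NP_subset_EXP_holds : NP ⊆ EXP`** (the discharge: `NP = ∃ᵖ·P ⊆ ∃ᵖ·EXP ⊆ EXP`);
* **`EXP_subset_NEXP : EXP ⊆ NEXP`** (`DTIME(2^{nᵏ}) ⊆ NTIME(2^{n^{k+1}})` by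
  `DTIME_subset_NTIME_of_dominated`, the verifier discarding its certificate).

## References

* S. Arora, B. Barak, *Computational Complexity: A Modern Approach*, CUP 2009, Claim 2.4 and its
  proof (p. 40: `P ⊆ NP ⊆ EXP`, "enumerate all possible `u` … runs in `2^{O(p(n))}` time"),
  §2.6.2 (`EXP`, `NEXP`, `EXP ⊆ NEXP`), Thm. 2.8 (closure under reductions), §1.3 (composition).
-/

namespace Literature.Computability.Complexity

open _root_.Computability Turing Polynomial NKannan

/-! ### Arithmetic: the currency `2^{q(n)}` -/

/-- Every `ℕ`-polynomial is below a single power plus a constant: `q(n) ≤ n^d + C`. [folklore] -/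
theorem exists_eval_le_pow_add (q : Polynomial ℕ) : ∃ d C : ℕ, ∀ n : ℕ, q.eval n ≤ n ^ d + C := by
  obtain ⟨c, k, hck⟩ := exists_eval_le_mul_pow_add q
  refine ⟨k + 1, c ^ (k + 1) + c, fun n => (hck n).trans ?_⟩
  rcases le_or_gt c n with hcn | hnc
  · have : c * n ^ k ≤ n ^ (k + 1) := by
      rw [pow_succ']
      exact Nat.mul_le_mul_right _ hcn
    omega
  · have : c * n ^ k ≤ c ^ (k + 1) := by
      rw [pow_succ']
      exact Nat.mul_le_mul_left _ (Nat.pow_le_pow_left hnc.le k)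
    omega

/-- `C · M + C ≤ 2^{C + M}`. [folklore] -/
theorem mul_add_le_two_pow (C M : ℕ) : C * M + C ≤ 2 ^ (C + M) := by
  have hC : C ≤ 2 ^ C := (Nat.lt_two_pow_self).le
  have hM : M + 1 ≤ 2 ^ M := Nat.lt_two_pow_self
  calc C * M + C = C * (M + 1) := by ring
    _ ≤ 2 ^ C * 2 ^ M := Nat.mul_le_mul hC hM
    _ = 2 ^ (C + M) := (pow_add 2 C M).symm

/-- The composition bookkeeping: `C · (P + (a · 2^m + a) + S) + C ≤ 2^{m + C + P + S + 2a}`.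
[folklore] -/
theorem comp_bound_le_two_pow (C P a m S : ℕ) :
    C * (P + (a * 2 ^ m + a) + S) + C ≤ 2 ^ (m + C + P + S + 2 * a) := by
  have h2 : 1 ≤ 2 ^ m := Nat.one_le_two_pow
  have h1 : P + (a * 2 ^ m + a) + S ≤ 2 ^ m * (P + S + 2 * a) := by nlinarith
  calc C * (P + (a * 2 ^ m + a) + S) + C ≤ C * (2 ^ m * (P + S + 2 * a)) + C := by gcongr
    _ ≤ 2 ^ m * (C * (P + S + 2 * a) + C) := by nlinarith
    _ ≤ 2 ^ m * 2 ^ (C + (P + S + 2 * a)) := Nat.mul_le_mul_left _ (mul_add_le_two_pow C _)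
    _ = 2 ^ (m + C + P + S + 2 * a) := by
        rw [← pow_add]
        congr 1
        omega

/-- **Into `EXP`**: a language decided within `T n ≤ 2^{q(n)}` steps, `q` a polynomial, is in
`EXP` (`2^{q(n)} ≤ 2^C · 2^{n^d}`). [cite: AroraBarak2009, §2.6.2] -/
theorem mem_EXP_of_le_two_pow_eval {L : Language Bool} {T : ℕ → ℕ} (q : Polynomial ℕ)
    (hT : ∀ n, T n ≤ 2 ^ q.eval n) (h : TimeDecidable id L T) : L ∈ EXP := by
  obtain ⟨d, C, hC⟩ := exists_eval_le_pow_add q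
  obtain ⟨M, hM⟩ := h
  have hle : ∀ n, T n ≤ 2 ^ C * 2 ^ (n ^ d) + 2 ^ C := fun n =>
    calc T n ≤ 2 ^ q.eval n := hT n
      _ ≤ 2 ^ (n ^ d + C) := Nat.pow_le_pow_right Nat.two_pos (hC n)
      _ = 2 ^ C * 2 ^ (n ^ d) := by rw [pow_add, mul_comm]
      _ ≤ _ := Nat.le_add_right _ _
  simp only [EXP, Set.mem_iUnion]
  exact ⟨d, 2 ^ C, M, hM.mono fun x => hle _⟩

/-- `a · 2^m + a ≤ 2^{m + 2a}`. [folklore] -/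
theorem mul_two_pow_add_le (a m : ℕ) : a * 2 ^ m + a ≤ 2 ^ (m + 2 * a) := by
  have h1 : a ≤ a * 2 ^ m := Nat.le_mul_of_pos_right _ Nat.one_le_two_pow
  have h2 : 2 * a ≤ 2 ^ (2 * a) := (Nat.lt_two_pow_self).le
  calc a * 2 ^ m + a ≤ 2 * a * 2 ^ m := by
        rw [two_mul, add_mul]
        exact Nat.add_le_add_left h1 _
    _ ≤ 2 ^ (2 * a) * 2 ^ m := Nat.mul_le_mul_right _ h2
    _ = 2 ^ (m + 2 * a) := by rw [pow_add, mul_comm]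

/-- **Out of `EXP`**: a language in `EXP` is decided within `2^{q(n)}` steps for some polynomial
`q` (`a · 2^{n^k} + a ≤ 2^{n^k + 2a}`). [cite: AroraBarak2009, §2.6.2] -/
theorem exists_two_pow_eval_of_mem_EXP {L : Language Bool} (h : L ∈ EXP) :
    ∃ q : Polynomial ℕ, TimeDecidable id L fun n => 2 ^ q.eval n := by
  simp only [EXP, Set.mem_iUnion] at h
  obtain ⟨k, a, M, hM⟩ := h
  refine ⟨X ^ k + Polynomial.C (2 * a), M, hM.mono fun x => ?_⟩
  simp only [eval_add, eval_pow, eval_X, eval_C]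
  exact mul_two_pow_add_le a _

/-- `EXP` is closed under complement (`compl_mem_DTIME_iff`). [cite: AroraBarak2009, §2.6.2] -/
@[simp] theorem compl_mem_EXP_iff {L : Language Bool} : Lᶜ ∈ EXP ↔ L ∈ EXP := by
  simp only [EXP, Set.mem_iUnion, compl_mem_DTIME_iff]

/-! ### `EXP` is closed under polynomial-time preimages -/

/-- **`f⁻¹(A) ∈ EXP` for `A ∈ EXP`, `f ∈ FP`**: compute `f` (polynomial time, output length
`≤ s(n)`), then run the `2^{q}`-time decider of `A` on the output (`TimeComputable.comp_holds`);
the total is `≤ 2^{q(s(n)) + O(poly)}`. [cite: AroraBarak2009, Thm. 2.8 (proof) and §2.6.2] -/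
theorem preimage_mem_EXP_of_mem_FP {A : Language Bool} (hA : A ∈ EXP) {f : List Bool → List Bool}
    (hf : f ∈ FP) : (f ⁻¹' A : Language Bool) ∈ EXP := by
  obtain ⟨q, hdec⟩ := exists_two_pow_eval_of_mem_EXP hA
  obtain ⟨s, hs⟩ := exists_poly_length_le_of_mem_FP hf
  obtain ⟨p, hp⟩ := hf
  have hdec' : TimeComputable (id : List Bool → List Bool) encodeBool A.boolIndicator
      fun n => 2 ^ q.eval n := hdec
  have hmono : Monotone fun n : ℕ => 2 ^ q.eval n := fun x y hxy =>
    Nat.pow_le_pow_right Nat.two_pos (TM2Iter.eval_mono q hxy)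
  obtain ⟨C, hC⟩ := TimeComputable.comp_holds hdec' hp hmono (s := fun n => s.eval n)
    (fun x => hs x)
  have hind : A.boolIndicator ∘ f = (f ⁻¹' A).boolIndicator := by
    funext w
    rfl
  rw [hind] at hC
  have hC' : TimeDecidable id (f ⁻¹' A)
      fun n => C * (p.eval n + 2 ^ q.eval (s.eval n) + s.eval n) + C := hC
  refine mem_EXP_of_le_two_pow_eval (q.comp s + Polynomial.C (C + 2) + p + s) (fun n => ?_) hC'
  have hB : 2 ^ q.eval (s.eval n) ≤ 1 * 2 ^ q.eval (s.eval n) + 1 := by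
    rw [one_mul]
    exact Nat.le_succ _
  have h0 : C * (p.eval n + 2 ^ q.eval (s.eval n) + s.eval n) + C ≤
      C * (p.eval n + (1 * 2 ^ q.eval (s.eval n) + 1) + s.eval n) + C :=
    Nat.add_le_add_right (Nat.mul_le_mul_left C
      (Nat.add_le_add_right (Nat.add_le_add_left hB (p.eval n)) (s.eval n))) C
  refine h0.trans ((comp_bound_le_two_pow C (p.eval n) 1 (q.eval (s.eval n)) (s.eval n)).trans
    (Nat.pow_le_pow_right Nat.two_pos ?_))
  simp only [eval_add, eval_comp, eval_C]
  omega

/-- **`EXP` is closed downward under Karp reductions**: `L₁ ≤ₚ L₂`, `L₂ ∈ EXP ⇒ L₁ ∈ EXP`.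
[cite: AroraBarak2009, Thm. 2.8 and §2.6.2] -/
theorem mem_EXP_of_karpReducible {L₁ L₂ : Language Bool} (h : PolyTimeKarpReducible L₁ L₂)
    (h₂ : L₂ ∈ EXP) : L₁ ∈ EXP := by
  obtain ⟨f, hf, hfL⟩ := h
  have hpre : L₁ = f ⁻¹' L₂ := Set.ext hfL
  rw [hpre]
  exact preimage_mem_EXP_of_mem_FP h₂ hf

/-! ### Certificate search: `∃ᵖ·EXP ⊆ EXP` -/

/-- A `DTIME(T)` language is decided within `c · T N + c` steps on words of length `N`, at every
level `k` of `NKannan.DecIn`. [folklore] -/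
theorem NKannan.DecIn.of_mem_DTIME {A : Language Bool} {T : ℕ → ℕ} (hA : A ∈ DTIME T) (k : ℕ) :
    ∃ c : ℕ, DecIn k A fun _ N => c * T N + c := by
  obtain ⟨c, M, hM⟩ := hA
  exact ⟨c, M, hM⟩

/-- The producer of `0^{p(|x|)+1}` (polynomial time: `Kannan.zerosFn ∘ Plumb.polyFn (p + 1)`).
[folklore] -/
theorem NKannan.unaryProducer_eval_succ (p : Polynomial ℕ) : UnaryProducer fun n => p.eval n + 1 := by
  have hF : Kannan.zerosFn ∘ Plumb.polyFn (p + 1) ∈ FP :=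
    comp_mem_FP Kannan.zerosFn_mem_FP (Plumb.polyFn_mem_FP _)
  obtain ⟨q, U, hU⟩ := hF
  have hS : ∀ x : List Bool, 1 ≤ x.length + 1 := fun x => Nat.succ_pos _
  refine unaryProducer_of_bnd U (T := fun x => q.eval x.length) (fun x => ?_)
    (Bnd.poly hS q (Bnd.of_le_lin hS 1 fun x => by omega))
  have e : (Kannan.zerosFn ∘ Plumb.polyFn (p + 1)) x = List.replicate (p.eval x.length + 1) false := by
    rw [Function.comp_apply, Kannan.zerosFn_apply, Plumb.polyFn_apply, List.length_replicate, eval_add,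
      eval_one]
  have h := hU x
  change U.OutputsWithin x ((Kannan.zerosFn ∘ Plumb.polyFn (p + 1)) x) (q.eval x.length) at h
  rwa [e] at h

/-- The decoding map `⟨x, y'⟩ ↦ ⟨x, decode y'⟩` (front-padding code `0^{m-|y|} 1 y`,
`NKannan.decode`) is the library map `fanoutFn fstP (decode ∘ sndP)`; its value on pairs. [folklore] -/
@[simp] theorem decodeSndFn_boolPair (x y' : List Bool) :
    fanoutFn fstP (NKannan.decode ∘ sndP) (boolPair x y') = boolPair x (NKannan.decode y') := by
  simp [Function.comp]

/-- The decoding map is in `FP`. [folklore] -/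
theorem decodeSndFn_mem_FP : fanoutFn fstP (NKannan.decode ∘ sndP) ∈ FP :=
  fanoutFn_mem_FP fstP_mem_FP (comp_mem_FP NKannan.decode_mem_FP sndP_mem_FP)

/-- **Witnesses of length `≤ m` through codes of length `m + 1`**: for a language of pairs `L'`,
`(∃ y, |y| ≤ m ∧ ⟨x, y⟩ ∈ L') ↔ ∃ y' ∈ {0,1}^{m+1}, ⟨x, decode y'⟩ ∈ L'` (encode `y` as
`0^{m-|y|} 1 y`; a decoded word is shorter by one). [folklore] -/
theorem exists_length_le_iff_exists_code (L' : Language Bool) (x : List Bool) (m : ℕ) :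
    (∃ y : List Bool, y.length ≤ m ∧ boolPair x y ∈ L') ↔
      ∃ y' : List Bool, y'.length = m + 1 ∧ boolPair x y' ∈ (fanoutFn fstP (NKannan.decode ∘ sndP) ⁻¹' L' : Language Bool) := by
  constructor
  · rintro ⟨y, hy, hyL⟩
    refine ⟨List.replicate (m - y.length) false ++ true :: y, ?_, ?_⟩
    · simp only [List.length_append, List.length_replicate, List.length_cons]
      omega
    · rw [Set.mem_preimage, decodeSndFn_boolPair, NKannan.decode_code]
      exact hyL
  · rintro ⟨y', hy', hyL⟩
    rw [Set.mem_preimage, decodeSndFn_boolPair] at hyL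
    refine ⟨NKannan.decode y', ?_, hyL⟩
    have := NKannan.length_decode_le y'
    omega

/-- **`∃ᵖ·EXP ⊆ EXP`: exhaustive search over polynomially bounded certificates** (Arora–Barak
2009, proof of Claim 2.4: "enumerate all possible `u` and check whether `M(x, u) = 1` … the
machine runs in `2^{O(p(n))}` time", there for a polynomial-time `M`; the same with a
`2^{poly}`-time matrix). For `L = {x | ∃ y, |y| ≤ p(|x|) ∧ ⟨x, y⟩ ∈ L'}`, `L' ∈ EXP`: the
language `V = (fanout fst (decode ∘ snd))⁻¹(L')` is in `EXP` (`preimage_mem_EXP_of_mem_FP`), `L` is the bounded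
existential quantifier `BEX 0 (p + 1) V` over codes of exact length `p(n) + 1`
(`exists_length_le_iff_exists_code`), decided by `NKannan.DecIn.bex` within
`2^{c (n + p(n) + 2)} · (2^{q(2n + 3 + p(n))} + 1) ≤ 2^{poly(n)}` steps.
[cite: AroraBarak2009, Claim 2.4 (proof)] -/
theorem polyExists_EXP_subset_EXP : polyExists EXP ⊆ EXP := by
  rintro L ⟨L', hL', p, hp⟩
  -- the matrix over codes
  have hVE : (fanoutFn fstP (NKannan.decode ∘ sndP) ⁻¹' L' : Language Bool) ∈ EXP :=
    preimage_mem_EXP_of_mem_FP hL' decodeSndFn_mem_FP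
  obtain ⟨q, hq⟩ := exists_two_pow_eval_of_mem_EXP hVE
  have hV1 : DecIn 1 (fanoutFn fstP (NKannan.decode ∘ sndP) ⁻¹' L' : Language Bool)
      fun _ N => 1 * 2 ^ q.eval N + 1 := by
    obtain ⟨M, hM⟩ := hq
    exact ⟨M, hM.mono fun u => by simp⟩
  -- the bounded quantifier
  have hL : L = BEX 0 (fun n => p.eval n + 1) (fanoutFn fstP (NKannan.decode ∘ sndP) ⁻¹' L') := by
    ext x
    rw [hp x, mem_BEX, exists_length_le_iff_exists_code]
    simp only [Function.iterate_zero, id_eq]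
    exact Iff.rfl
  obtain ⟨c, hc⟩ := hV1.bex (NKannan.unaryProducer_eval_succ p)
  obtain ⟨M, hM⟩ := hc
  rw [hL]
  refine mem_EXP_of_le_two_pow_eval
    (T := fun n => bexCost c (fun n => p.eval n + 1) (fun _ N => 1 * 2 ^ q.eval N + 1) n n)
    (Polynomial.C c * (X + p + 2) + q.comp (2 * X + 3 + p) + 2) (fun n => ?_) ⟨M, fun u => hM u⟩
  -- the cost is `2^{poly}`
  simp only [bexCost, one_mul, eval_add, eval_mul, eval_C, eval_X, eval_comp, eval_ofNat]
  have h1 : 2 ^ q.eval (2 * n + 2 + (p.eval n + 1)) + 1 + 1 ≤ 2 ^ (q.eval (2 * n + 3 + p.eval n) + 2) := by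
    have e : 2 * n + 2 + (p.eval n + 1) = 2 * n + 3 + p.eval n := by omega
    have h4 : (2 : ℕ) ^ (q.eval (2 * n + 3 + p.eval n) + 2) = 2 ^ q.eval (2 * n + 3 + p.eval n) * 4 := by
      rw [pow_add]
      norm_num
    rw [e, h4]
    have : 1 ≤ 2 ^ q.eval (2 * n + 3 + p.eval n) := Nat.one_le_two_pow
    omega
  calc 2 ^ (c * (n + (p.eval n + 1) + 1)) * (2 ^ q.eval (2 * n + 2 + (p.eval n + 1)) + 1 + 1)
      ≤ 2 ^ (c * (n + (p.eval n + 1) + 1)) * 2 ^ (q.eval (2 * n + 3 + p.eval n) + 2) :=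
        Nat.mul_le_mul_left _ h1
    _ = 2 ^ (c * (n + p.eval n + 2) + q.eval (2 * n + 3 + p.eval n) + 2) := by
        rw [← pow_add]
        congr 1

/-- **`∀ᵖ·EXP ⊆ EXP`** (`polyForall = co ∘ polyExists ∘ co` and `co EXP = EXP`).
[cite: AroraBarak2009, Claim 2.4 (proof)] -/
theorem polyForall_EXP_subset_EXP : polyForall EXP ⊆ EXP := by
  intro L hL
  have hco : co EXP = EXP := co_eq_self_of_compl_mem_iff fun _ => compl_mem_EXP_iff
  change Lᶜ ∈ polyExists (co EXP) at hL
  rw [hco] at hL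
  exact compl_mem_EXP_iff.1 (polyExists_EXP_subset_EXP hL)

/-- **Discharge of `NP_subset_EXP`** (`Nondeterministic.lean`; Arora–Barak 2009, Claim 2.4:
`NP ⊆ EXP`, "enumerate all certificates of length `≤ p |x|`"): `NP = ∃ᵖ·P ⊆ ∃ᵖ·EXP ⊆ EXP`.
[cite: AroraBarak2009, Claim 2.4] -/
theorem NP_subset_EXP_holds : NP_subset_EXP := fun _ hL =>
  polyExists_EXP_subset_EXP (polyExists_mono P_subset_EXP hL)

/-! ### `EXP ⊆ NEXP` -/

/-- **`DTIME(2^{nᵏ}) ⊆ NTIME(2^{n^{k+1}})`** (Arora–Barak 2009, §2.6.2: deterministic time is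
nondeterministic time; the verifier discards its certificate, `DTIME_subset_NTIME_of_dominated`,
and `poly(n) + a · 2^{nᵏ} + a = O(2^{n^{k+1}})`). [cite: AroraBarak2009, §2.6.2] -/
theorem DTIME_two_pow_pow_subset_NTIME (k : ℕ) :
    DTIME (fun n => 2 ^ (n ^ k)) ⊆ NTIME (fun n => 2 ^ (n ^ (k + 1))) := by
  refine DTIME_subset_NTIME_of_dominated fun a p => ?_
  obtain ⟨b, hb⟩ := TimeConstructible.exists_poly_le_two_pow_pow p (k := k + 1) (by omega)
  refine ⟨b + 3 * a, fun n => ?_⟩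
  have h1 := hb n
  have h2 : 2 ^ (n ^ k) ≤ 2 ^ (n ^ (k + 1)) + 2 := by
    rcases Nat.eq_zero_or_pos n with rfl | hn
    · rcases Nat.eq_zero_or_pos k with rfl | hk <;> simp [Nat.pos_iff_ne_zero.mp, *]
    · exact le_add_right (Nat.pow_le_pow_right Nat.two_pos (Nat.pow_le_pow_right hn (Nat.le_succ k)))
  have h3 : 1 ≤ 2 ^ (n ^ (k + 1)) := Nat.one_le_two_pow
  nlinarith

/-- **`EXP ⊆ NEXP`** (Arora–Barak 2009, §2.6.2: "`P ⊆ NP ⊆ EXP ⊆ NEXP`").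
[cite: AroraBarak2009, §2.6.2] -/
theorem EXP_subset_NEXP : EXP ⊆ NEXP := by
  intro L hL
  simp only [EXP, Set.mem_iUnion] at hL
  obtain ⟨k, hk⟩ := hL
  simp only [NEXP, Set.mem_iUnion]
  exact ⟨k + 1, DTIME_two_pow_pow_subset_NTIME k hk⟩

end Literature.Computability.Complexity
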